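import Literature.NumberTheory.LFunctions.PartialEulerProductsPrimeSums
import Literature.NumberTheory.Sieve.BombieriAsymptoticSieveMertens
import Mathlib.Analysis.PSeries
import HarnessLib

/-!
# Rankin's method for reciprocal sums over `S`-composed numbers, and the prime sums `∑_{p ≤ Q} p^{η-1}`

Topic `Literature/NumberTheory/Sieve`.  Everything in this file is PROVED: the elementary estimates behind
"by an estimate for the number of `Q`-smooth numbers" in the proof of Matomäki–Radziwiłł 2016, Lemma 3
(Ann. of Math. 183 (2016), §2), in the form needed there — a reciprocal sum over numbers composed of
primes from a finite set `S` (e.g. `S = 𝒫 ∩ [P, Q]`) beyond a threshold `Z`: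

* `RankinComposed.sum_inv_le_rankin` — **Rankin's trick**: for `0 < σ ≤ 1`,
  `∑_{n ∈ R} 1/n ≤ Z^{-(1-σ)} ∏_{p ∈ S} (1 - p^{-σ})⁻¹` for any finite set `R` of `S`-factored `n ≥ Z`
  (the Euler product over `Nat.factoredNumbers S` via `BombieriSieve.sum_le_prod_tsum_of_factored`;
  Montgomery–Vaughan §7.1 (7.17)).
* `RankinComposed.prod_inv_le_exp` — `∏_{p ∈ S} (1 - p^{-σ})⁻¹ ≤ exp(∑_{p ∈ S} p^{-σ} + C₀)` for
  `σ ≥ 3/5` (`C₀ = 2 ∑ n^{-6/5}`; from `(1-x)⁻¹ ≤ e^{x + 2x²}`, `x ≤ 4/5`).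
* `RankinComposed.sum_excess_le` — **the excess over Mertens**: `∑_{p ≤ Q} (p^η - 1)/p ≤ 3 + 24 Q^η` for
  `0 < η ≤ 1/2` (so that with `η = log u/log Q`, `∑_{p ∈ S} p^{-(1-η)} ≤ ∑_{p ∈ S} 1/p + O(u)`; this is the
  `e^{O(u)}` in Rankin's bound `Ψ(x, y) ≪ x e^{-u log u + O(u)} log y`).  The proof is a dyadic
  decomposition in `log p` (`p ∈ (Q^{(j-1)/J}, Q^{j/J}]`, `J = ⌈log₂ Q^η⌉`, weight `p^η ≤ 2^j`) using only the
  upper half of Mertens' first theorem (`MertensBound.sum_log_div_prime_le`), hence with no threshold.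
* `RankinComposed.exists_abs_sum_inv_primes_Icc_sub_le` — **Mertens on intervals**:
  `|∑_{P ≤ p ≤ Q} 1/p − (log log Q − log log P)| ≤ C` for all `2 ≤ P ≤ Q` (from the tree's two-sided
  Mertens theorem `PartialEuler.exists_abs_sum_primesLE_inv_sub_loglog_le` of
  `PartialEulerProductsPrimeSums.lean`).

## References
* H. L. Montgomery, R. C. Vaughan, *Multiplicative Number Theory I*, CUP 2007, §7.1 (Rankin's method).
* K. Matomäki, M. Radziwiłł, Ann. of Math. (2) 183 (2016), §2, proof of Lemma 3.
  [cite: MatomakiRadziwillAnnals2016, Lemma 3 (proof)]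
* R. A. Rankin, J. London Math. Soc. 13 (1938), 242–247.

## Design choices
* `S` is any finite set of primes (`Nat.factoredNumbers S`), not only an initial segment as in
  `RankinSmoothTail.lean` (which treats `Nat.smoothNumbersUpTo` with `δ = 1/log k`); the two files are
  complementary.  Constants are explicit except `C₀` (a convergent series) and the Mertens constant.
-/

noncomputable section

open Finset Real

namespace Literature.NumberTheory.Sieve

namespace RankinComposed

/-! ### Rankin's trick for the reciprocal tail over `S`-factored numbers -/

/-- `n ↦ n^{-σ}` on `ℕ` (real values).  This is the bare function underlying the monoid hom
`Literature.NumberTheory.Sieve.rpowNegHom` of `RankinSmoothNumbers.lean` (its twin; kept local to avoid that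
file's `import Mathlib` closure, cf. the precedent `FriedlanderIwaniecPrimesProp21.lean`). [folklore] -/
def powWt (σ : ℝ) (n : ℕ) : ℝ := (n : ℝ) ^ (-σ)

/-- `powWt_nonneg` (elementary). [folklore] -/
theorem powWt_nonneg (σ : ℝ) (n : ℕ) : 0 ≤ powWt σ n := by unfold powWt; positivity

/-- `powWt_one` (elementary). [folklore] -/
theorem powWt_one (σ : ℝ) : powWt σ 1 = 1 := by simp [powWt]

/-- `powWt_mul` (elementary). [folklore] -/
theorem powWt_mul (σ : ℝ) (m n : ℕ) : powWt σ (m * n) = powWt σ m * powWt σ n := by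
  unfold powWt; push_cast; exact Real.mul_rpow (Nat.cast_nonneg m) (Nat.cast_nonneg n)

/-- `powWt_prime_pow` (elementary). [folklore] -/
theorem powWt_prime_pow {p : ℕ} (σ : ℝ) (k : ℕ) : powWt σ (p ^ k) = ((p : ℝ) ^ (-σ)) ^ k := by
  unfold powWt; push_cast
  rw [← Real.rpow_natCast, ← Real.rpow_mul (Nat.cast_nonneg p), ← Real.rpow_natCast,
    ← Real.rpow_mul (Nat.cast_nonneg p), mul_comm]

/-- The local factor: for `p ≥ 2`, `σ > 0`, `∑_k (p^k)^{-σ} = (1 - p^{-σ})⁻¹`, absolutely convergent.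
[folklore] -/
theorem hasSum_powWt_prime_pow {p : ℕ} (hp : 2 ≤ p) {σ : ℝ} (hσ : 0 < σ) :
    Summable (fun k : ℕ => ‖powWt σ (p ^ k)‖) ∧
      ∑' k : ℕ, powWt σ (p ^ k) = (1 - (p : ℝ) ^ (-σ))⁻¹ := by
  have hp1 : (1 : ℝ) < p := by exact_mod_cast hp
  have hr : (p : ℝ) ^ (-σ) < 1 := Real.rpow_lt_one_of_one_lt_of_neg hp1 (by linarith)
  have hr0 : 0 ≤ (p : ℝ) ^ (-σ) := by positivity
  have e : (fun k : ℕ => powWt σ (p ^ k)) = fun k => ((p : ℝ) ^ (-σ)) ^ k := funext (powWt_prime_pow σ)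
  refine ⟨?_, ?_⟩
  · simp only [Real.norm_eq_abs, abs_of_nonneg (powWt_nonneg _ _), e]
    exact summable_geometric_of_lt_one hr0 hr
  · rw [e, tsum_geometric_of_lt_one hr0 hr]

/-- **Rankin's trick (reciprocal tail over `S`-composed numbers)**: for a finite set of primes `S`,
`0 < σ ≤ 1`, `Z > 0` and any finite set `R` of `S`-factored numbers `≥ Z`,
`∑_{n ∈ R} 1/n ≤ Z^{-(1-σ)} ∏_{p ∈ S} (1 - p^{-σ})⁻¹`
(`1/n = n^{-σ} n^{-(1-σ)} ≤ n^{-σ} Z^{-(1-σ)}` and the Euler product over `S`-factored numbers).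
(Montgomery–Vaughan §7.1; Rankin 1938.) [folklore] -/
theorem sum_inv_le_rankin {S : Finset ℕ} (hS : ∀ p ∈ S, p.Prime) {σ : ℝ} (hσ0 : 0 < σ) (hσ1 : σ ≤ 1)
    {Z : ℝ} (hZ : 0 < Z) {R : Finset ℕ} (hR : ∀ n ∈ R, n ∈ Nat.factoredNumbers S ∧ Z ≤ n) :
    ∑ n ∈ R, (1 : ℝ) / n ≤ Z ^ (-(1 - σ)) * ∏ p ∈ S, (1 - (p : ℝ) ^ (-σ))⁻¹ := by
  classical
  -- Euler product over `S`-factored numbers (`BombieriSieve.sum_le_prod_tsum_of_factored`)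
  have hle : ∑ n ∈ R, powWt σ n ≤ ∏ p ∈ S, (1 - (p : ℝ) ^ (-σ))⁻¹ := by
    have h := BombieriSieve.sum_le_prod_tsum_of_factored (h := powWt σ) (powWt_one σ)
      (fun {m n} _ => powWt_mul σ m n) (powWt_nonneg σ)
      (fun {p} hp => by
        have := (hasSum_powWt_prime_pow hp.two_le hσ0).1
        exact this.of_norm) hS (D := R) (fun n hn => (hR n hn).1)
    refine h.trans_eq (Finset.prod_congr rfl fun p hp => (hasSum_powWt_prime_pow (hS p hp).two_le hσ0).2)
  -- termwise `1/n ≤ Z^{-(1-σ)} n^{-σ}`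
  have hpt : ∀ n ∈ R, (1 : ℝ) / n ≤ Z ^ (-(1 - σ)) * powWt σ n := by
    intro n hn
    obtain ⟨-, hZn⟩ := hR n hn
    have hn0 : (0 : ℝ) < n := lt_of_lt_of_le hZ hZn
    have e : (1 : ℝ) / n = (n : ℝ) ^ (-(1 - σ)) * powWt σ n := by
      rw [powWt, ← Real.rpow_add hn0, show -(1 - σ) + -σ = (-1 : ℝ) by ring, Real.rpow_neg_one,
        one_div]
    rw [e]
    exact mul_le_mul_of_nonneg_right
      (Real.rpow_le_rpow_of_nonpos hZ hZn (by linarith)) (powWt_nonneg _ _)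
  calc ∑ n ∈ R, (1 : ℝ) / n ≤ ∑ n ∈ R, Z ^ (-(1 - σ)) * powWt σ n := Finset.sum_le_sum hpt
    _ = Z ^ (-(1 - σ)) * ∑ n ∈ R, powWt σ n := by rw [Finset.mul_sum]
    _ ≤ Z ^ (-(1 - σ)) * ∏ p ∈ S, (1 - (p : ℝ) ^ (-σ))⁻¹ :=
        mul_le_mul_of_nonneg_left hle (by positivity)

/-! ### The Euler product `∏ (1 - p^{-σ})⁻¹ ≤ e^{C₀} exp(∑ p^{-σ})` for `σ ≥ 3/5` -/

/-- `(1 - x)⁻¹ ≤ exp(x + 2x²)` for `0 ≤ x ≤ 4/5` (from `e^y ≥ 1 + y + y²/2`). [folklore] -/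
theorem inv_one_sub_le_exp {x : ℝ} (hx0 : 0 ≤ x) (hx1 : x ≤ 4 / 5) :
    (1 - x)⁻¹ ≤ Real.exp (x + 2 * x ^ 2) := by
  have h1x : 0 < 1 - x := by linarith
  rw [inv_le_iff_one_le_mul₀ h1x]
  have hq := Real.quadratic_le_exp_of_nonneg (x := x + 2 * x ^ 2) (by positivity)
  have hpoly : 1 ≤ (1 - x) * (1 + (x + 2 * x ^ 2) + (x + 2 * x ^ 2) ^ 2 / 2) := by
    nlinarith [sq_nonneg x, mul_nonneg hx0 (sq_nonneg x), pow_nonneg hx0 3, pow_nonneg hx0 4,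
      pow_nonneg hx0 5]
  calc (1 : ℝ) ≤ (1 - x) * (1 + (x + 2 * x ^ 2) + (x + 2 * x ^ 2) ^ 2 / 2) := hpoly
    _ ≤ (1 - x) * Real.exp (x + 2 * x ^ 2) := mul_le_mul_of_nonneg_left hq h1x.le
    _ = Real.exp (x + 2 * x ^ 2) * (1 - x) := mul_comm _ _

/-- The absolute constant `C₀ = 2 ∑_{n ≥ 1} n^{-6/5}` (`= 2ζ(6/5)`). [folklore] -/
def C₀ : ℝ := 2 * ∑' n : ℕ, (n : ℝ) ^ (-(6 / 5 : ℝ))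

/-- `summable_rpow_neg_six_fifths` (elementary). [folklore] -/
theorem summable_rpow_neg_six_fifths : Summable (fun n : ℕ => (n : ℝ) ^ (-(6 / 5 : ℝ))) :=
  Real.summable_nat_rpow.2 (by norm_num)

/-- **The product bound**: for a finite set of primes `S` and `σ ≥ 3/5`,
`∏_{p ∈ S} (1 - p^{-σ})⁻¹ ≤ exp(∑_{p ∈ S} p^{-σ} + C₀)`. [folklore] -/
theorem prod_inv_le_exp {S : Finset ℕ} (hS : ∀ p ∈ S, p.Prime) {σ : ℝ} (hσ : 3 / 5 ≤ σ) :
    ∏ p ∈ S, (1 - (p : ℝ) ^ (-σ))⁻¹ ≤ Real.exp (∑ p ∈ S, (p : ℝ) ^ (-σ) + C₀) := by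
  classical
  have hx : ∀ p ∈ S, 0 ≤ (p : ℝ) ^ (-σ) ∧ (p : ℝ) ^ (-σ) ≤ 4 / 5 := by
    intro p hp
    have hp2 : (2 : ℝ) ≤ p := by exact_mod_cast (hS p hp).two_le
    refine ⟨by positivity, ?_⟩
    calc (p : ℝ) ^ (-σ) ≤ (2 : ℝ) ^ (-σ) := Real.rpow_le_rpow_of_nonpos (by norm_num) hp2 (by linarith)
      _ ≤ (2 : ℝ) ^ (-(3 / 5 : ℝ)) := Real.rpow_le_rpow_of_exponent_le (by norm_num) (by linarith)
      _ ≤ 4 / 5 := by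
          -- `2^{-3/5} ≤ 4/5` iff `(5/4)^5 ≤ 2^3`
          have h : ((2 : ℝ) ^ (-(3 / 5 : ℝ))) ^ (5 : ℕ) = 1 / 8 := by
            rw [← Real.rpow_natCast, ← Real.rpow_mul (by norm_num)]; norm_num
          have h0 : 0 ≤ (2 : ℝ) ^ (-(3 / 5 : ℝ)) := by positivity
          by_contra hlt
          push Not at hlt
          have := pow_lt_pow_left₀ hlt (by norm_num) (by norm_num : (5 : ℕ) ≠ 0)
          rw [h] at this; norm_num at this
  -- termwise and multiply
  have hfac : ∀ p ∈ S, (1 - (p : ℝ) ^ (-σ))⁻¹ ≤ Real.exp ((p : ℝ) ^ (-σ) + 2 * ((p : ℝ) ^ (-σ)) ^ 2) :=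
    fun p hp => inv_one_sub_le_exp (hx p hp).1 (hx p hp).2
  have hfac0 : ∀ p ∈ S, 0 ≤ (1 - (p : ℝ) ^ (-σ))⁻¹ := fun p hp =>
    inv_nonneg.2 (by linarith [(hx p hp).2])
  have h1 : ∏ p ∈ S, (1 - (p : ℝ) ^ (-σ))⁻¹ ≤
      Real.exp (∑ p ∈ S, ((p : ℝ) ^ (-σ) + 2 * ((p : ℝ) ^ (-σ)) ^ 2)) := by
    rw [Real.exp_sum]; exact Finset.prod_le_prod hfac0 hfac
  refine h1.trans (Real.exp_le_exp.2 ?_)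
  rw [Finset.sum_add_distrib, ← Finset.mul_sum]
  -- `∑_{p ∈ S} p^{-2σ} ≤ ∑_n n^{-6/5}`
  have hsq : ∑ p ∈ S, ((p : ℝ) ^ (-σ)) ^ 2 ≤ ∑' n : ℕ, (n : ℝ) ^ (-(6 / 5 : ℝ)) := by
    have hpt : ∀ p ∈ S, ((p : ℝ) ^ (-σ)) ^ 2 ≤ (p : ℝ) ^ (-(6 / 5 : ℝ)) := by
      intro p hp
      have hp1 : (1 : ℝ) ≤ p := by exact_mod_cast (hS p hp).one_lt.le
      rw [← Real.rpow_natCast, ← Real.rpow_mul (Nat.cast_nonneg p)]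
      exact Real.rpow_le_rpow_of_exponent_le hp1 (by push_cast; linarith)
    calc ∑ p ∈ S, ((p : ℝ) ^ (-σ)) ^ 2 ≤ ∑ p ∈ S, (p : ℝ) ^ (-(6 / 5 : ℝ)) := Finset.sum_le_sum hpt
      _ ≤ ∑' n : ℕ, (n : ℝ) ^ (-(6 / 5 : ℝ)) :=
          summable_rpow_neg_six_fifths.sum_le_tsum S (fun n _ => by positivity)
  unfold C₀
  linarith

/-! ### The prime sum `∑_{p ≤ Q} (p^η - 1)/p ≪ Q^η` -/

/-- `e^a - 1 ≤ a e^a` for `a ≥ 0`; hence `p^η - 1 ≤ η log p · p^η`. [folklore] -/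
theorem rpow_sub_one_le {p : ℕ} (hp : 1 ≤ p) {η : ℝ} (hη : 0 ≤ η) :
    (p : ℝ) ^ η - 1 ≤ η * Real.log p * (p : ℝ) ^ η := by
  have hp0 : (0 : ℝ) < p := by exact_mod_cast hp
  set a := η * Real.log p with ha
  have ha0 : 0 ≤ a := mul_nonneg hη (Real.log_nonneg (by exact_mod_cast hp))
  have e : (p : ℝ) ^ η = Real.exp a := by rw [Real.rpow_def_of_pos hp0, ha, mul_comm]
  rw [e]
  -- `e^a - 1 ≤ a e^a` iff `1 - a ≤ e^{-a}`... use `1 - a ≤ e^{-a}` times `e^a`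
  have h := Real.add_one_le_exp (-a)
  have hexp : Real.exp (-a) * Real.exp a = 1 := by rw [← Real.exp_add]; simp
  nlinarith [Real.exp_pos a, Real.exp_pos (-a)]

/-- Mertens I (upper half) at a real cut-off `A ≥ 1`: `∑_{p ≤ A} log p/p ≤ log A + log 4` (cf.
`MertensBound.sum_log_div_prime_bounds` in `MertensTail.lean` for the two-sided version). [folklore] -/
theorem mertens_real {A : ℝ} (hA : 1 ≤ A) :
    ∑ p ∈ Nat.primesLE ⌊A⌋₊, Real.log p / p ≤ Real.log A + Real.log 4 := by
  have h := Literature.NumberTheory.LFunctions.MertensBound.sum_log_div_prime_le ⌊A⌋₊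
  have hfl : (1 : ℝ) ≤ ⌊A⌋₊ := by exact_mod_cast Nat.one_le_floor_iff _ |>.2 hA
  have : Real.log (⌊A⌋₊ : ℝ) ≤ Real.log A := Real.log_le_log (by linarith) (Nat.floor_le (by linarith))
  linarith

/-- Small primes: if `A^η ≤ 2` then `∑_{p ≤ A} (p^η - 1)/p ≤ 2η (log A + log 4)` (as `p^η - 1 ≤ η log p · p^η`).
[folklore] -/
theorem sum_excess_small {A η : ℝ} (hA : 1 ≤ A) (hη : 0 ≤ η) (hA2 : A ^ η ≤ 2) :
    ∑ p ∈ Nat.primesLE ⌊A⌋₊, ((p : ℝ) ^ η - 1) / p ≤ 2 * η * (Real.log A + Real.log 4) := by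
  have hpt : ∀ p ∈ Nat.primesLE ⌊A⌋₊, ((p : ℝ) ^ η - 1) / p ≤ 2 * η * (Real.log p / p) := by
    intro p hp
    have hp' := (Nat.mem_primesLE.1 hp)
    have hp1 : 1 ≤ p := hp'.2.one_lt.le
    have hp0 : (0 : ℝ) < p := by exact_mod_cast hp'.2.pos
    have hpA : (p : ℝ) ≤ A := (Nat.cast_le.2 hp'.1).trans (Nat.floor_le (by linarith))
    have hpη : (p : ℝ) ^ η ≤ 2 := (Real.rpow_le_rpow hp0.le hpA hη).trans hA2
    have h1 := rpow_sub_one_le hp1 hη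
    have hlogp : 0 ≤ Real.log p := Real.log_nonneg (by exact_mod_cast hp1)
    rw [div_le_iff₀ hp0]
    calc (p : ℝ) ^ η - 1 ≤ η * Real.log p * (p : ℝ) ^ η := h1
      _ ≤ η * Real.log p * 2 := mul_le_mul_of_nonneg_left hpη (by positivity)
      _ = 2 * η * (Real.log p / p) * p := by field_simp
  calc ∑ p ∈ Nat.primesLE ⌊A⌋₊, ((p : ℝ) ^ η - 1) / p
      ≤ ∑ p ∈ Nat.primesLE ⌊A⌋₊, 2 * η * (Real.log p / p) := Finset.sum_le_sum hpt
    _ = 2 * η * ∑ p ∈ Nat.primesLE ⌊A⌋₊, Real.log p / p := by rw [Finset.mul_sum]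
    _ ≤ 2 * η * (Real.log A + Real.log 4) := mul_le_mul_of_nonneg_left (mertens_real hA) (by positivity)

/-- The thresholds `A_j = Q^{j/J}`. [folklore] -/
def thr (Q J j : ℕ) : ℝ := (Q : ℝ) ^ ((j : ℝ) / J)

/-- `one_le_thr` (elementary). [folklore] -/
theorem one_le_thr {Q : ℕ} (hQ : 1 ≤ Q) (J j : ℕ) : 1 ≤ thr Q J j :=
  Real.one_le_rpow (by exact_mod_cast hQ) (by positivity)

/-- `log_thr` (elementary). [folklore] -/
theorem log_thr {Q : ℕ} (hQ : 1 ≤ Q) (J j : ℕ) : Real.log (thr Q J j) = (j : ℝ) / J * Real.log Q := by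
  unfold thr; exact Real.log_rpow (by exact_mod_cast hQ) _

/-- `thr_mono` (elementary). [folklore] -/
theorem thr_mono {Q : ℕ} (hQ : 1 ≤ Q) (J : ℕ) {i j : ℕ} (hij : i ≤ j) : thr Q J i ≤ thr Q J j :=
  Real.rpow_le_rpow_of_exponent_le (by exact_mod_cast hQ)
    (div_le_div_of_nonneg_right (Nat.cast_le.2 hij) (Nat.cast_nonneg J))

/-- `thr_self` (elementary). [folklore] -/
theorem thr_self {Q J : ℕ} (hJ : 0 < J) : thr Q J J = Q := by
  have : (J : ℝ) ≠ 0 := by exact_mod_cast hJ.ne'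
  simp [thr, div_self this]

/-- `A_j^η ≤ 2^j` when `η log Q ≤ J log 2`. [folklore] -/
theorem thr_rpow_le {Q : ℕ} (hQ : 1 ≤ Q) {J : ℕ} (hJ : 0 < J) {η : ℝ}
    (hηJ : η * Real.log Q ≤ J * Real.log 2) (j : ℕ) : (thr Q J j) ^ η ≤ (2 : ℝ) ^ j := by
  have hJ0 : (0 : ℝ) < J := by exact_mod_cast hJ
  have h1 : Real.log ((thr Q J j) ^ η) ≤ Real.log ((2 : ℝ) ^ j) := by
    rw [Real.log_rpow (by linarith [one_le_thr hQ J j]), log_thr hQ, Real.log_pow]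
    calc η * ((j : ℝ) / J * Real.log Q) = j * (η * Real.log Q / J) := by ring
      _ ≤ j * Real.log 2 := by
          refine mul_le_mul_of_nonneg_left ?_ (Nat.cast_nonneg j)
          rw [div_le_iff₀ hJ0]; linarith
  exact (Real.log_le_log_iff (by have := one_le_thr hQ J j; positivity) (by positivity)).1 h1

/-- The range of a large prime: for `A_1 < p ≤ Q` there is `j ∈ [2, J]` with `A_{j-1} < p ≤ A_j`, and
then `(p^η - 1)/p ≤ 2^j (log p / log A_{j-1}) / p`; written as a bound by the sum over all `j` of the
indicator-weighted terms. [folklore] -/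
theorem excess_term_le {Q : ℕ} (hQ : 2 ≤ Q) {J : ℕ} (hJ : 0 < J) {η : ℝ} (hη : 0 ≤ η)
    (hηJ : η * Real.log Q ≤ J * Real.log 2) {p : ℕ} (hp : p ∈ Nat.primesLE Q) (hpA1 : thr Q J 1 < p) :
    ((p : ℝ) ^ η - 1) / p ≤ ∑ j ∈ Finset.Icc 2 J,
      (if thr Q J (j - 1) < p ∧ (p : ℝ) ≤ thr Q J j
        then (2 : ℝ) ^ j / Real.log (thr Q J (j - 1)) * (Real.log p / p) else 0) := by
  classical
  have hQ1 : 1 ≤ Q := by omega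
  have hQ1' : (1 : ℝ) < Q := by exact_mod_cast (by omega : 1 < Q)
  have hlogQ : 0 < Real.log Q := Real.log_pos hQ1'
  have hJ0 : (0 : ℝ) < J := by exact_mod_cast hJ
  have hp' := Nat.mem_primesLE.1 hp
  have hp0 : (0 : ℝ) < p := by exact_mod_cast hp'.2.pos
  have hpQ : (p : ℝ) ≤ Q := by exact_mod_cast hp'.1
  have hA1 := one_le_thr hQ1 J 1
  have hlogp : 0 < Real.log p := Real.log_pos (by linarith)
  -- the index `j = ⌈J log p / log Q⌉`
  set x : ℝ := J * Real.log p / Real.log Q with hx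
  have hlogp_eq : Real.log p = x / J * Real.log Q := by rw [hx]; field_simp
  have hx1 : 1 < x := by
    have h1 : Real.log (thr Q J 1) < Real.log p := Real.log_lt_log (by linarith) hpA1
    rw [log_thr hQ1] at h1; push_cast at h1
    rw [hx, lt_div_iff₀ hlogQ, one_mul]
    have e : (1 : ℝ) / J * Real.log Q * J = Real.log Q := by field_simp
    nlinarith
  have hxJ : x ≤ J := by
    rw [hx, div_le_iff₀ hlogQ]
    exact mul_le_mul_of_nonneg_left (Real.log_le_log hp0 hpQ) hJ0.le
  set j : ℕ := ⌈x⌉₊ with hj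
  have hjx : x ≤ j := Nat.le_ceil x
  have hjx' : (j : ℝ) < x + 1 := Nat.ceil_lt_add_one (by linarith)
  have hj2 : 2 ≤ j := by
    have : (1 : ℝ) < j := hx1.trans_le hjx
    exact_mod_cast this
  have hjJ : j ≤ J := by
    have : (j : ℝ) < J + 1 := by linarith
    exact_mod_cast Nat.lt_add_one_iff.1 (by exact_mod_cast this)
  have hmem : j ∈ Finset.Icc 2 J := Finset.mem_Icc.2 ⟨hj2, hjJ⟩
  have hjm1 : ((j - 1 : ℕ) : ℝ) = j - 1 := by rw [Nat.cast_sub (by omega)]; simp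
  -- `A (j-1) < p ≤ A j`
  have hpj : (p : ℝ) ≤ thr Q J j := by
    have h1 : Real.log p ≤ Real.log (thr Q J j) := by
      rw [log_thr hQ1, hlogp_eq]
      exact mul_le_mul_of_nonneg_right (div_le_div_of_nonneg_right hjx hJ0.le) hlogQ.le
    exact (Real.log_le_log_iff hp0 (by linarith [one_le_thr hQ1 J j])).1 h1
  have hpj' : thr Q J (j - 1) < p := by
    have h1 : Real.log (thr Q J (j - 1)) < Real.log p := by
      rw [log_thr hQ1, hlogp_eq, hjm1]
      exact mul_lt_mul_of_pos_right (div_lt_div_of_pos_right (by linarith) hJ0) hlogQ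
    exact (Real.log_lt_log_iff (by linarith [one_le_thr hQ1 J (j-1)]) hp0).1 h1
  -- only the term `j` matters
  rw [← Finset.add_sum_erase _ _ hmem, if_pos ⟨hpj', hpj⟩]
  have hrest : 0 ≤ ∑ i ∈ (Finset.Icc 2 J).erase j,
      (if thr Q J (i - 1) < p ∧ (p : ℝ) ≤ thr Q J i
        then (2 : ℝ) ^ i / Real.log (thr Q J (i - 1)) * (Real.log p / p) else 0) := by
    refine Finset.sum_nonneg fun i _ => ?_
    split_ifs
    · exact mul_nonneg (div_nonneg (by positivity) (Real.log_nonneg (one_le_thr hQ1 _ _))) (by positivity)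
    · exact le_rfl
  have hlogA1 : 0 < Real.log (thr Q J (j - 1)) := by
    rw [log_thr hQ1, hjm1]
    have : (0 : ℝ) < (j : ℝ) - 1 := by
      have : (2 : ℝ) ≤ j := by exact_mod_cast hj2
      linarith
    positivity
  have hratio : 1 ≤ Real.log p / Real.log (thr Q J (j - 1)) := by
    rw [le_div_iff₀ hlogA1, one_mul]
    exact Real.log_le_log (by linarith [one_le_thr hQ1 J (j-1)]) hpj'.le
  have hpη : (p : ℝ) ^ η ≤ (2 : ℝ) ^ j :=
    (Real.rpow_le_rpow hp0.le hpj hη).trans (thr_rpow_le hQ1 hJ hηJ j)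
  have hmain : ((p : ℝ) ^ η - 1) / p ≤ (2 : ℝ) ^ j / Real.log (thr Q J (j - 1)) * (Real.log p / p) := by
    rw [div_le_iff₀ hp0]
    calc (p : ℝ) ^ η - 1 ≤ (2 : ℝ) ^ j * 1 := by linarith
      _ ≤ (2 : ℝ) ^ j * (Real.log p / Real.log (thr Q J (j - 1))) :=
          mul_le_mul_of_nonneg_left hratio (by positivity)
      _ = (2 : ℝ) ^ j / Real.log (thr Q J (j - 1)) * (Real.log p / p) * p := by field_simp
  linarith

/-- The contribution of the range `j ≥ 2`: `(2^j / log A_{j-1}) ∑_{p ≤ A_j} log p/p ≤ 6 · 2^j`, using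
`log A_j ≤ 2 log A_{j-1}` and `log 4 ≤ 4 log A_{j-1}` (the latter from `log Q / J ≥ (log 2)/2`). [folklore] -/
theorem range_le {Q : ℕ} (hQ : 2 ≤ Q) {J : ℕ} (hJ : 0 < J) (hQJ : Real.log 2 / 2 ≤ Real.log Q / J)
    {j : ℕ} (hj : 2 ≤ j) :
    (2 : ℝ) ^ j / Real.log (thr Q J (j - 1)) * ∑ p ∈ Nat.primesLE ⌊thr Q J j⌋₊, Real.log p / p ≤
      6 * (2 : ℝ) ^ j := by
  have hQ1 : 1 ≤ Q := by omega
  have hlogQ : 0 < Real.log Q := Real.log_pos (by exact_mod_cast (by omega : 1 < Q))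
  have hJ0 : (0 : ℝ) < J := by exact_mod_cast hJ
  have hlog2 : (0.6931471803 : ℝ) < Real.log 2 := Real.log_two_gt_d9
  have hlog4 : Real.log 4 = 2 * Real.log 2 := by
    rw [show (4 : ℝ) = 2 ^ 2 by norm_num, Real.log_pow]; norm_num
  have hjm1 : (1 : ℝ) ≤ ((j - 1 : ℕ) : ℝ) := by exact_mod_cast (by omega : 1 ≤ j - 1)
  have hlogA1 : 0 < Real.log (thr Q J (j - 1)) := by rw [log_thr hQ1]; positivity
  have hm := mertens_real (one_le_thr hQ1 J j)
  rw [div_mul_eq_mul_div, div_le_iff₀ hlogA1]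
  have hbound : Real.log (thr Q J j) + Real.log 4 ≤ 6 * Real.log (thr Q J (j - 1)) := by
    rw [log_thr hQ1, log_thr hQ1]
    have e : ((j : ℕ) : ℝ) = ((j - 1 : ℕ) : ℝ) + 1 := by
      rw [Nat.cast_sub (by omega)]; push_cast; ring
    set m : ℝ := ((j - 1 : ℕ) : ℝ) with hm'
    have h0 : Real.log Q / J ≤ m / J * Real.log Q := by
      rw [div_mul_eq_mul_div]; exact div_le_div_of_nonneg_right (by nlinarith) hJ0.le
    have h1 : (j : ℝ) / J * Real.log Q = m / J * Real.log Q + Real.log Q / J := by rw [e]; ring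
    rw [h1]
    nlinarith
  calc (2 : ℝ) ^ j * ∑ p ∈ Nat.primesLE ⌊thr Q J j⌋₊, Real.log p / p
      ≤ (2 : ℝ) ^ j * (Real.log (thr Q J j) + Real.log 4) := mul_le_mul_of_nonneg_left hm (by positivity)
    _ ≤ (2 : ℝ) ^ j * (6 * Real.log (thr Q J (j - 1))) := mul_le_mul_of_nonneg_left hbound (by positivity)
    _ = 6 * (2 : ℝ) ^ j * Real.log (thr Q J (j - 1)) := by ring

/-- **The excess over Mertens**: for `Q ≥ 2` and `0 < η ≤ 1/2`,
`∑_{p ≤ Q} (p^η - 1)/p ≤ 3 + 24 Q^η`.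
Proof: with `u₁ = Q^η` and `J = ⌈log u₁/log 2⌉`, on `Q^{(j-1)/J} < p ≤ Q^{j/J}` one has `p^η ≤ 2^j`
and `∑_{Q^{(j-1)/J} < p ≤ Q^{j/J}} 1/p ≤ (1/log Q^{(j-1)/J}) ∑_{p ≤ Q^{j/J}} log p/p ≤ 6`
(Mertens' first theorem, upper half: `MertensBound.sum_log_div_prime_le`); on `p ≤ Q^{1/J}`,
`p^η - 1 ≤ 2η log p`. [folklore] -/
theorem sum_excess_le {Q : ℕ} (hQ : 2 ≤ Q) {η : ℝ} (hη0 : 0 < η) (hη1 : η ≤ 1 / 2) :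
    ∑ p ∈ Nat.primesLE Q, ((p : ℝ) ^ η - 1) / p ≤ 3 + 24 * (Q : ℝ) ^ η := by
  classical
  have hQ1 : 1 ≤ Q := by omega
  have hQ0 : (0 : ℝ) < Q := by exact_mod_cast (by omega : 0 < Q)
  have hQ1' : (1 : ℝ) < Q := by exact_mod_cast (by omega : 1 < Q)
  have hlogQ : 0 < Real.log Q := Real.log_pos hQ1'
  have hlog2 : (0.6931471803 : ℝ) < Real.log 2 := Real.log_two_gt_d9
  have hlog2' : Real.log 2 < 0.6931471808 := Real.log_two_lt_d9
  have hlog4 : Real.log 4 = 2 * Real.log 2 := by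
    rw [show (4 : ℝ) = 2 ^ 2 by norm_num, Real.log_pow]; norm_num
  set u₁ : ℝ := (Q : ℝ) ^ η with hu₁
  have hu₁1 : 1 ≤ u₁ := Real.one_le_rpow hQ1'.le hη0.le
  have hlogu₁ : Real.log u₁ = η * Real.log Q := by rw [hu₁, Real.log_rpow hQ0]
  -- Case `u₁ ≤ 2`
  rcases le_or_gt u₁ 2 with hu2 | hu2
  · have h := sum_excess_small (A := Q) hQ1'.le hη0.le (by rw [← hu₁]; exact hu2)
    rw [Nat.floor_natCast] at h
    have e2 : Real.log u₁ ≤ Real.log 2 := Real.log_le_log (by linarith) hu2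
    have h3 : 2 * η * (Real.log Q + Real.log 4) ≤ 3 := by
      have e1 : 2 * η * Real.log Q = 2 * Real.log u₁ := by rw [hlogu₁]; ring
      have : 2 * η * Real.log 4 ≤ Real.log 4 := by nlinarith
      nlinarith
    have : 0 ≤ 24 * u₁ := by positivity
    linarith
  -- Case `u₁ > 2`: `J = ⌈log u₁ / log 2⌉ ≥ 2`
  set J : ℕ := ⌈Real.log u₁ / Real.log 2⌉₊ with hJ
  have hlogu₁0 : Real.log 2 < Real.log u₁ := Real.log_lt_log (by norm_num) hu2
  have hJge : Real.log u₁ / Real.log 2 ≤ J := Nat.le_ceil _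
  have hJlt : (J : ℝ) < Real.log u₁ / Real.log 2 + 1 :=
    Nat.ceil_lt_add_one (div_nonneg (by linarith) (by linarith))
  have hJ2 : 2 ≤ J := by
    have : (1 : ℝ) < Real.log u₁ / Real.log 2 := by rw [lt_div_iff₀ (by linarith)]; linarith
    have : (1 : ℝ) < J := this.trans_le hJge
    exact_mod_cast this
  have hJpos : 0 < J := by omega
  have hJ0 : (0 : ℝ) < J := by exact_mod_cast hJpos
  have hηJ : η * Real.log Q ≤ J * Real.log 2 := by
    rw [← hlogu₁]; rw [div_le_iff₀ (by linarith)] at hJge; linarith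
  have hJlog : (J : ℝ) * Real.log 2 < Real.log u₁ + Real.log 2 := by
    have := hJlt; rw [← sub_lt_iff_lt_add] at this
    have := (lt_div_iff₀ (by linarith : (0:ℝ) < Real.log 2)).1 this; linarith
  have hQJ : Real.log 2 / 2 ≤ Real.log Q / J := by
    have h2 : Real.log u₁ ≤ Real.log Q / 2 := by rw [hlogu₁]; nlinarith
    have h3 : Real.log 2 ≤ Real.log Q := Real.log_le_log (by norm_num) (by exact_mod_cast hQ)
    rw [div_le_div_iff₀ (by norm_num) hJ0]
    nlinarith
  -- split the primes at `A 1`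
  set P1 := (Nat.primesLE Q).filter (fun p : ℕ => (p : ℝ) ≤ thr Q J 1) with hP1
  set P2 := (Nat.primesLE Q).filter (fun p : ℕ => ¬ (p : ℝ) ≤ thr Q J 1) with hP2
  have hsplit : ∑ p ∈ Nat.primesLE Q, ((p : ℝ) ^ η - 1) / p
      = ∑ p ∈ P1, ((p : ℝ) ^ η - 1) / p + ∑ p ∈ P2, ((p : ℝ) ^ η - 1) / p :=
    (Finset.sum_filter_add_sum_filter_not _ _ _).symm
  -- small primes
  have hS1 : ∑ p ∈ P1, ((p : ℝ) ^ η - 1) / p ≤ 3 := by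
    have hsub : P1 = Nat.primesLE ⌊thr Q J 1⌋₊ := by
      ext p
      simp only [hP1, Finset.mem_filter, Nat.mem_primesLE]
      constructor
      · rintro ⟨⟨-, hp⟩, hpA⟩; exact ⟨Nat.le_floor hpA, hp⟩
      · rintro ⟨hpA, hp⟩
        have h1 : (p : ℝ) ≤ thr Q J 1 := (Nat.le_floor_iff (by linarith [one_le_thr hQ1 J 1])).1 hpA
        refine ⟨⟨?_, hp⟩, h1⟩
        have : (p : ℝ) ≤ Q := h1.trans (by
          have := thr_mono hQ1 J (show 1 ≤ J by omega); rwa [thr_self hJpos] at this)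
        exact_mod_cast this
    rw [hsub]
    have h := sum_excess_small (one_le_thr hQ1 J 1) hη0.le ((thr_rpow_le hQ1 hJpos hηJ 1).trans (by norm_num))
    have h3 : 2 * η * (Real.log (thr Q J 1) + Real.log 4) ≤ 3 := by
      rw [log_thr hQ1]; push_cast
      have e1 : η * (1 / (J : ℝ) * Real.log Q) ≤ Real.log 2 := by
        rw [show η * (1 / (J : ℝ) * Real.log Q) = η * Real.log Q / J by ring, div_le_iff₀ hJ0]; linarith
      have e2 : 2 * η * Real.log 4 ≤ Real.log 4 := by nlinarith
      nlinarith
    linarith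
  -- large primes
  have hS2 : ∑ p ∈ P2, ((p : ℝ) ^ η - 1) / p ≤ 24 * u₁ := by
    calc ∑ p ∈ P2, ((p : ℝ) ^ η - 1) / p
        ≤ ∑ p ∈ P2, ∑ j ∈ Finset.Icc 2 J,
            (if thr Q J (j - 1) < p ∧ (p : ℝ) ≤ thr Q J j
              then (2 : ℝ) ^ j / Real.log (thr Q J (j - 1)) * (Real.log p / p) else 0) :=
          Finset.sum_le_sum fun p hp => by
            rw [hP2, Finset.mem_filter] at hp
            exact excess_term_le hQ hJpos hη0.le hηJ hp.1 (lt_of_not_ge hp.2)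
      _ = ∑ j ∈ Finset.Icc 2 J, ∑ p ∈ P2,
            (if thr Q J (j - 1) < p ∧ (p : ℝ) ≤ thr Q J j
              then (2 : ℝ) ^ j / Real.log (thr Q J (j - 1)) * (Real.log p / p) else 0) :=
          Finset.sum_comm
      _ ≤ ∑ j ∈ Finset.Icc 2 J, 6 * (2 : ℝ) ^ j := by
          refine Finset.sum_le_sum fun j hj => ?_
          have hj2 : 2 ≤ j := (Finset.mem_Icc.1 hj).1
          have hjm1 : (1 : ℝ) ≤ ((j - 1 : ℕ) : ℝ) := by exact_mod_cast (by omega : 1 ≤ j - 1)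
          have hlogA1 : 0 < Real.log (thr Q J (j - 1)) := by rw [log_thr hQ1]; positivity
          have hc : 0 ≤ (2 : ℝ) ^ j / Real.log (thr Q J (j - 1)) := by positivity
          calc ∑ p ∈ P2, (if thr Q J (j - 1) < p ∧ (p : ℝ) ≤ thr Q J j
                  then (2 : ℝ) ^ j / Real.log (thr Q J (j - 1)) * (Real.log p / p) else 0)
              ≤ ∑ p ∈ Nat.primesLE ⌊thr Q J j⌋₊, (2 : ℝ) ^ j / Real.log (thr Q J (j - 1)) * (Real.log p / p) := by
                rw [← Finset.sum_filter]
                refine Finset.sum_le_sum_of_subset_of_nonneg (fun p hp => ?_) fun p hp _ => ?_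
                · simp only [hP2, Finset.mem_filter, Nat.mem_primesLE] at hp ⊢
                  exact ⟨Nat.le_floor hp.2.2, hp.1.1.2⟩
                · have hp1 : 1 ≤ p := (Nat.mem_primesLE.1 hp).2.one_lt.le
                  exact mul_nonneg hc (div_nonneg (Real.log_nonneg (by exact_mod_cast hp1)) (Nat.cast_nonneg p))
            _ = (2 : ℝ) ^ j / Real.log (thr Q J (j - 1)) * ∑ p ∈ Nat.primesLE ⌊thr Q J j⌋₊, Real.log p / p := by
                rw [Finset.mul_sum]
            _ ≤ 6 * (2 : ℝ) ^ j := range_le hQ hJpos hQJ hj2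
      _ = 6 * ∑ j ∈ Finset.Icc 2 J, (2 : ℝ) ^ j := by rw [Finset.mul_sum]
      _ ≤ 6 * (2 : ℝ) ^ (J + 1) := by
          refine mul_le_mul_of_nonneg_left ?_ (by norm_num)
          calc ∑ j ∈ Finset.Icc 2 J, (2 : ℝ) ^ j ≤ ∑ j ∈ Finset.range (J + 1), (2 : ℝ) ^ j :=
                Finset.sum_le_sum_of_subset_of_nonneg (fun j hj => by
                  rw [Finset.mem_Icc] at hj; rw [Finset.mem_range]; omega) fun _ _ _ => by positivity
            _ = (2 : ℝ) ^ (J + 1) - 1 := by rw [geom_sum_eq (by norm_num)]; ring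
            _ ≤ (2 : ℝ) ^ (J + 1) := by linarith
      _ ≤ 24 * u₁ := by
          have h1 : (2 : ℝ) ^ (J - 1) ≤ u₁ := by
            have hlt : ((J - 1 : ℕ) : ℝ) * Real.log 2 ≤ Real.log u₁ := by
              have : ((J - 1 : ℕ) : ℝ) = J - 1 := by rw [Nat.cast_sub (by omega)]; simp
              rw [this]; linarith
            have h2 : Real.log ((2 : ℝ) ^ (J - 1)) ≤ Real.log u₁ := by rw [Real.log_pow]; exact hlt
            exact (Real.log_le_log_iff (by positivity) (by linarith)).1 h2
          have e : (2 : ℝ) ^ (J + 1) = 4 * (2 : ℝ) ^ (J - 1) := by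
            rw [show J + 1 = (J - 1) + 2 by omega, pow_add]; ring
          rw [e]; linarith
  rw [hsplit]
  linarith

/-! ### Mertens' second theorem on intervals of primes -/

/-- `log log N − log log (N − 1) ≤ 1` for `N ≥ 3`. [folklore] -/
theorem loglog_sub_loglog_pred_le {N : ℕ} (hN : 3 ≤ N) :
    Real.log (Real.log N) - Real.log (Real.log ((N - 1 : ℕ) : ℝ)) ≤ 1 := by
  have hN' : ((N - 1 : ℕ) : ℝ) = N - 1 := by rw [Nat.cast_sub (by omega)]; simp
  have hN3 : (3 : ℝ) ≤ N := by exact_mod_cast hN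
  rw [hN']
  have hl2 : (0.6931471803 : ℝ) < Real.log 2 := Real.log_two_gt_d9
  have hlog1 : Real.log 2 ≤ Real.log ((N : ℝ) - 1) := Real.log_le_log (by norm_num) (by linarith)
  have hlog0 : 0 < Real.log ((N : ℝ) - 1) := by linarith
  -- `log N ≤ log (N-1) + 1/(N-1) ≤ log(N-1) + 1/2`
  have hlogN : Real.log N ≤ Real.log ((N : ℝ) - 1) + 1 / 2 := by
    have h := Real.log_le_sub_one_of_pos (show 0 < (N : ℝ) / (N - 1) from div_pos (by linarith) (by linarith))
    rw [Real.log_div (by positivity) (by linarith)] at h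
    have : (N : ℝ) / (N - 1) - 1 = 1 / (N - 1) := by
      rw [div_sub_one (by linarith : (N : ℝ) - 1 ≠ 0)]; congr 1; ring
    rw [this] at h
    have : 1 / ((N : ℝ) - 1) ≤ 1 / 2 := by rw [div_le_div_iff₀ (by linarith) (by norm_num)]; linarith
    linarith
  -- `log log N − log log(N−1) = log (log N / log(N−1)) ≤ log N/log(N−1) − 1 ≤ (1/2)/log(N−1) ≤ 1`
  have h1 : Real.log (Real.log N) - Real.log (Real.log ((N : ℝ) - 1)) =
      Real.log (Real.log N / Real.log ((N : ℝ) - 1)) := by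
    rw [Real.log_div (by have := Real.log_pos (by linarith : (1:ℝ) < N); linarith) hlog0.ne']
  rw [h1]
  have h2 := Real.log_le_sub_one_of_pos (show 0 < Real.log N / Real.log ((N : ℝ) - 1) by
    have := Real.log_pos (by linarith : (1:ℝ) < N); positivity)
  have h3 : Real.log N / Real.log ((N : ℝ) - 1) - 1 ≤ 1 := by
    rw [div_sub_one hlog0.ne', div_le_iff₀ hlog0]; linarith
  linarith

/-- **Mertens on an interval of primes**: there is an absolute `C` with
`|∑_{P ≤ p ≤ Q} 1/p − (log log Q − log log P)| ≤ C` for all `2 ≤ P ≤ Q` (naturals); from the tree's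
two-sided Mertens theorem `PartialEuler.exists_abs_sum_primesLE_inv_sub_loglog_le`.  (The lower half holds
even with a vanishing error: `MertensBound.loglog_sub_loglog_le_sum_inv_prime_Icc`, `MertensTail.lean`.)
[folklore] -/
theorem exists_abs_sum_inv_primes_Icc_sub_le :
    ∃ C : ℝ, ∀ P Q : ℕ, 2 ≤ P → P ≤ Q →
      |∑ p ∈ (Finset.Icc P Q).filter Nat.Prime, (1 : ℝ) / p
        - (Real.log (Real.log Q) - Real.log (Real.log P))| ≤ C := by
  classical
  obtain ⟨C, hC⟩ := Literature.NumberTheory.LFunctions.PartialEuler.exists_abs_sum_primesLE_inv_sub_loglog_le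
  refine ⟨2 * C + 2, fun P Q hP hPQ => ?_⟩
  have hC0 : 0 ≤ C := le_trans (abs_nonneg _) (hC 2 le_rfl)
  -- `∑_{P ≤ p ≤ Q} = ∑_{p ≤ Q} − ∑_{p ≤ P − 1}`
  have hsplit : ∑ p ∈ (Finset.Icc P Q).filter Nat.Prime, (1 : ℝ) / p
      = ∑ p ∈ Nat.primesLE Q, (1 : ℝ) / p - ∑ p ∈ Nat.primesLE (P - 1), (1 : ℝ) / p := by
    have hu : Nat.primesLE Q = Nat.primesLE (P - 1) ∪ (Finset.Icc P Q).filter Nat.Prime := by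
      ext p; simp only [Finset.mem_union, Nat.mem_primesLE, Finset.mem_filter, Finset.mem_Icc]
      constructor
      · rintro ⟨hpQ, hp⟩
        by_cases h : p ≤ P - 1
        · exact Or.inl ⟨h, hp⟩
        · exact Or.inr ⟨⟨by omega, hpQ⟩, hp⟩
      · rintro (⟨h, hp⟩ | ⟨⟨-, h2⟩, hp⟩)
        · exact ⟨by omega, hp⟩
        · exact ⟨h2, hp⟩
    have hd : Disjoint (Nat.primesLE (P - 1)) ((Finset.Icc P Q).filter Nat.Prime) := by
      rw [Finset.disjoint_left]; intro p h1 h2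
      simp only [Nat.mem_primesLE, Finset.mem_filter, Finset.mem_Icc] at h1 h2
      have := h1.1; have := h2.1.1; omega
    rw [hu, Finset.sum_union hd]; ring
  rw [hsplit]
  have hQ := hC Q (hP.trans hPQ)
  rcases Nat.lt_or_ge P 3 with hP3 | hP3
  · -- `P = 2`: the lower sum is empty
    have hP2 : P = 2 := by omega
    subst hP2
    have h0 : ∑ p ∈ Nat.primesLE (2 - 1), (1 : ℝ) / p = 0 := by
      have : Nat.primesLE (2 - 1) = ∅ := by decide
      rw [this, Finset.sum_empty]
    rw [h0, sub_zero]
    -- `|log log 2| ≤ 1`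
    have hl2 : (0.6931471803 : ℝ) < Real.log 2 := Real.log_two_gt_d9
    have hl2' : Real.log 2 < 0.6931471808 := Real.log_two_lt_d9
    have hll2 : |Real.log (Real.log 2)| ≤ 1 := by
      rw [abs_le]; constructor
      · rw [← Real.log_exp (-1)]
        refine Real.log_le_log (Real.exp_pos _) ?_
        have := Real.exp_neg_one_lt_d9; linarith
      · have := Real.log_le_sub_one_of_pos (by linarith : 0 < Real.log 2); linarith
    push_cast
    have := abs_le.1 hQ; have := abs_le.1 hll2
    rw [abs_le]; constructor <;> linarith
  · have hPm := hC (P - 1) (by omega)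
    have hll := loglog_sub_loglog_pred_le hP3
    -- `log log (P-1) ≤ log log P`
    have hmono : Real.log (Real.log ((P - 1 : ℕ) : ℝ)) ≤ Real.log (Real.log P) := by
      have hP1 : ((P - 1 : ℕ) : ℝ) = P - 1 := by rw [Nat.cast_sub (by omega)]; simp
      have hP3' : (3 : ℝ) ≤ P := by exact_mod_cast hP3
      rw [hP1]
      have hl2 : (0.6931471803 : ℝ) < Real.log 2 := Real.log_two_gt_d9
      have : Real.log 2 ≤ Real.log ((P : ℝ) - 1) := Real.log_le_log (by norm_num) (by linarith)
      exact Real.log_le_log (by linarith) (Real.log_le_log (by linarith) (by linarith))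
    have h1 := abs_le.1 hQ; have h2 := abs_le.1 hPm
    rw [abs_le]; constructor <;> linarith

end RankinComposed

end Literature.NumberTheory.Sieve
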